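import Literature.Geometry.Lorentzian.KerrConvergence
import Summits.FinalStateConjecture.FinalStateConjecture.Theorems.ClusterCompletenessOmegaLimitMultiKerrNoPhantom
import HarnessLib

/-!
# Crux `ClusterCompleteness.OmegaLimitMultiKerr` (stmt-FinalStateConjecture-14664), line `Sketch` —
# the boosted exterior determines the sub-extremal label up to `a ↦ −a`

Structure stub `LabelDomain` of the line lead for the crux `OmegaLimitMultiKerr` (route
`ClusterCompleteness`): the recurrence interface fixes, per hole, a sub-extremal Kerr label `(M, a)`
(`Kerr.IsSubextremal`, `|a| < M`) and a motion `(Λ, c)`, and the hole chart is a map on the boosted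
exterior `boostedKerrExterior Λ c M a = (x ↦ Λ⁻¹(x − c)) ⁻¹' Kerr.exterior M a`
(`Literature.Geometry.Lorentzian.KerrConvergence`), where
`Kerr.exterior M a = {x | max r₊ 0 < r(a, x)}` (`Kerr.mem_exterior`), `r₊ = M + √(M² − a²)`
(O'Neill 1995, Ch. 2, §2.3) and `r(a, x)` is the Kerr–Schild radius
`r² = ((ρ² − a²) + √((ρ² − a²)² + 4a²z²))/2` (Visser arXiv:0706.0622, (35)).
"Select-and-rebase" would change the label of an era chart after the fact; this file certifies that
the chart DOMAIN already pins the label down up to the reflection `a ↦ −a`, so no re-basing of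
labels keeps the hole-chart domains of the crux:

* `boostedKerrExterior_eq_iff` (registered stub, closed form) — for sub-extremal `(M, a)`,
  `(M', a')` and every motion `(Λ, c)`,
  `boostedKerrExterior Λ c M a = boostedKerrExterior Λ c M' a' ↔ M = M' ∧ |a| = |a'|`.

Proof. (⇐) `r(a, ·)` and `r₊(M, a)` depend on `a` only through `a²`. (⇒) `x ↦ Λ⁻¹(x − c)` is onto
(`Λ y + c ↦ y`), so the rest-frame exteriors agree as subsets of `E4`; for sub-extremal labels
`0 < r₊`, so membership is `r₊ < r`. On the symmetry axis `r(a, (0, 0, 0, z)) = |z|` for every `a`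
(`radius_axis` of the sibling file `…NoPhantom`), whence `r₊(M, a) = r₊(M', a')`; on the equatorial
ray `w = (0, ρ, 0, 0)` one has `r(a, w) = √(ρ² − a²)` (junk value `0` inside the disc included),
so `w ∈ exterior ↔ r₊² + a² < ρ²`, whence `r₊² + a² = r₊'² + a'²`; together `a² = a'²`, and the
identity `r₊² + a² = 2 M r₊` (`|a| ≤ M`) with `r₊ = r₊' > 0` gives `M = M'`.

Sources: B. O'Neill, *The geometry of Kerr black holes* (1995), Ch. 2, §2.3 (the horizon radii
`r± = M ± √(M² − a²)`); M. Visser, arXiv:0706.0622, (35) (the Kerr–Schild radius).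
Everything is proved; Mathlib + `Literature` + the sibling stub file `…NoPhantom` only.
-/

-- every `Summit.FinalStateConjecture.FinalStateConjecture.…` name repeats the summit = sub-problem segment (D-0017 layout)
set_option linter.dupNamespace false

noncomputable section

open Set TopologicalSpace

namespace Summit.FinalStateConjecture.FinalStateConjecture.Theorems.ClusterCompleteness

open Literature.Geometry.Lorentzian

/-! ### The Kerr–Schild radius on the equatorial ray, and `a ↦ a²` -/

/-- **On the equatorial ray the Kerr–Schild radius is `√(ρ² − a²)`.** For `w = (0, ρ, 0, 0) = ρ • ∂₁`
one has `z = 0` and `‖w⃗‖² = ρ²`, so `r² = ((ρ² − a²) + |ρ² − a²|)/2 = max (ρ² − a²) 0` and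
`r = √(ρ² − a²)` for every real `ρ` (both sides vanish inside the disc `ρ² < a²`, `Real.sqrt` of a
negative number being `0`). Visser arXiv:0706.0622, (35) with `z = 0`; the tree's
`Kerr.radius_of_apply_three_eq_zero` is the case `a² < ρ²`. [cite: arXiv07060622, (35)] -/
private theorem radius_equatorialRay (a ρ : ℝ) :
    Kerr.radius a (ρ • E4.basisVector 1) = √(ρ ^ 2 - a ^ 2) := by
  set w : E4 := ρ • E4.basisVector 1 with hw
  have h3 : w 3 = 0 := by simp [hw]
  have hρ : E4.spatialNorm w ^ 2 = ρ ^ 2 := by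
    rw [E4.spatialNorm_sq]
    simp [hw]
  have hsq : Kerr.radius a w ^ 2 = √(ρ ^ 2 - a ^ 2) ^ 2 := by
    rw [Kerr.radius_sq, hρ, h3,
      show (ρ ^ 2 - a ^ 2) ^ 2 + 4 * a ^ 2 * (0 : ℝ) ^ 2 = (ρ ^ 2 - a ^ 2) ^ 2 by ring,
      Real.sqrt_sq_eq_abs]
    rcases le_or_gt 0 (ρ ^ 2 - a ^ 2) with h | h
    · rw [abs_of_nonneg h, Real.sq_sqrt h]
      ring
    · rw [abs_of_neg h, Real.sqrt_eq_zero'.2 h.le]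
      ring
  exact (pow_left_inj₀ (Kerr.radius_nonneg a w) (Real.sqrt_nonneg _) two_ne_zero).1 hsq

/-- For positive mass the exterior is `{r₊ < r}`: `0 < M` gives `0 < r₊ = M + √(M² − a²)`
(`Kerr.rPlus_pos`), so `max r₊ 0 = r₊` in `Kerr.mem_exterior`. O'Neill 1995, Ch. 2, §2.3.
[cite: ONeill1995, Ch. 2 §2.3] -/
private theorem mem_exterior_iff_of_pos {M : ℝ} (hM : 0 < M) (a : ℝ) {x : E4} :
    x ∈ Kerr.exterior M a ↔ Kerr.rPlus M a < Kerr.radius a x := by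
  rw [Kerr.mem_exterior, max_eq_left (Kerr.rPlus_pos hM a).le]

/-- `r₊² + a² = 2 M r₊` for sub-extremal parameters (`r₊` is a root of `Δ = r² − 2Mr + a²`;
O'Neill 1995, Ch. 2, §2.3). The tree's `Kerr.rPlus_sq_add_sq` (`KerrTimelikeSpan.lean`) is the same
identity under `|a| ≤ M`; restated privately to keep the imports of this stub minimal.
[cite: ONeill1995, Ch. 2 §2.3] -/
private theorem rPlus_sq_add_sq_of_isSubextremal {M a : ℝ} (h : Kerr.IsSubextremal M a) :
    Kerr.rPlus M a ^ 2 + a ^ 2 = 2 * M * Kerr.rPlus M a := by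
  have ha : a ^ 2 ≤ M ^ 2 := (sq_lt_sq' (abs_lt.1 h).1 (abs_lt.1 h).2).le
  have hs : √(M ^ 2 - a ^ 2) ^ 2 = M ^ 2 - a ^ 2 := Real.sq_sqrt (sub_nonneg.2 ha)
  unfold Kerr.rPlus
  linear_combination hs

/-- The Kerr exterior depends on `a` only through `a²`: `Kerr.exterior M a = Kerr.exterior M a'`
whenever `a² = a'²` (both `r(a, ·)` and `r₊(M, a)` are functions of `a²`; Visser
arXiv:0706.0622, (35); O'Neill 1995, Ch. 2, §2.3). [cite: arXiv07060622, (35)] -/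
private theorem exterior_eq_of_sq_eq (M : ℝ) {a a' : ℝ} (h : a ^ 2 = a' ^ 2) :
    Kerr.exterior M a = Kerr.exterior M a' := by
  have hr : Kerr.radius a = Kerr.radius a' := by
    funext x
    unfold Kerr.radius
    rw [h]
  have hp : Kerr.rPlus M a = Kerr.rPlus M a' := by
    unfold Kerr.rPlus
    rw [h]
  refine SetLike.ext fun x => ?_
  rw [Kerr.mem_exterior, Kerr.mem_exterior, hr, hp]

/-! ### The boosted exterior determines the label -/

/-- **The boosted Kerr exterior determines the sub-extremal label up to `a ↦ −a`.** For every
motion `(Λ, c)` and sub-extremal labels `(M, a)`, `(M', a')` (`|a| < M`, `|a'| < M'`):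
`boostedKerrExterior Λ c M a = boostedKerrExterior Λ c M' a' ↔ M = M' ∧ |a| = |a'|`.
(⇐) the Kerr–Schild radius `r(a, ·)` and `r₊ = M + √(M² − a²)` only see `a²`. (⇒) the inverse
Poincaré map `x ↦ Λ⁻¹(x − c)` is onto, so the rest-frame exteriors `{r₊ < r(a, ·)}` coincide; testing
them on the axis points `(0, 0, 0, z)` (`r = |z|`, `radius_axis`) gives `r₊ = r₊'`, on the
equatorial ray `(0, ρ, 0, 0)` (`r = √(ρ² − a²)`) gives `r₊² + a² = r₊'² + a'²`, hence `a² = a'²`,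
and `r₊² + a² = 2 M r₊`, `r₊ > 0` give `M = M'`. Consequence for the crux: a hole chart's domain
already fixes its Kerr label up to the reflection `a ↦ −a`, so labels cannot be re-based after the
fact without changing the certified domains. O'Neill 1995, Ch. 2, §2.3 (horizon radii); Visser
arXiv:0706.0622, (35) (the radius function). [cite: ONeill1995, Ch. 2 §2.3] -/
theorem boostedKerrExterior_eq_iff :
    ∀ (Λ : lorentzGroup) (c : E4) {M a M' a' : ℝ}, Kerr.IsSubextremal M a →
      Kerr.IsSubextremal M' a' →
      (boostedKerrExterior Λ c M a = boostedKerrExterior Λ c M' a' ↔ M = M' ∧ |a| = |a'|) := by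
  intro Λ c M a M' a' hMa hMa'
  constructor
  · intro h
    -- the rest-frame exteriors agree: evaluate at `x = Λ y + c`, `Λ⁻¹(x − c) = y`
    have hext : ∀ y : E4, y ∈ Kerr.exterior M a ↔ y ∈ Kerr.exterior M' a' := by
      intro y
      have hinv : poincareInv Λ c ((Λ : E4 ≃L[ℝ] E4) y + c) = y := by simp [poincareInv]
      have hy := SetLike.ext_iff.1 h ((Λ : E4 ≃L[ℝ] E4) y + c)
      rwa [mem_boostedKerrExterior, mem_boostedKerrExterior, hinv] at hy
    have hpos : 0 < Kerr.rPlus M a := Kerr.rPlus_pos hMa.pos a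
    have hpos' : 0 < Kerr.rPlus M' a' := Kerr.rPlus_pos hMa'.pos a'
    -- axis points `(0, 0, 0, z)`, `z > 0`: `r = z`, so `r₊ < z ↔ r₊' < z`
    have haxis : ∀ z : ℝ, 0 < z → (Kerr.rPlus M a < z ↔ Kerr.rPlus M' a' < z) := by
      intro z hz
      have hz' := hext ((0 : ℝ) • E4.basisVector 0 + z • E4.basisVector 3)
      rwa [mem_exterior_iff_of_pos hMa.pos, mem_exterior_iff_of_pos hMa'.pos, radius_axis,
        radius_axis, abs_of_pos hz] at hz'
    have hr : Kerr.rPlus M a = Kerr.rPlus M' a' := by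
      rcases lt_trichotomy (Kerr.rPlus M a) (Kerr.rPlus M' a') with hlt | heq | hgt
      · exact absurd ((haxis _ hpos').1 hlt) (lt_irrefl _)
      · exact heq
      · exact absurd ((haxis _ hpos).2 hgt) (lt_irrefl _)
    -- equatorial points `(0, ρ, 0, 0)`: `r = √(ρ² − a²)`, so `r₊² + a² < ρ² ↔ r₊'² + a'² < ρ²`
    have hequ : ∀ ρ : ℝ, (Kerr.rPlus M a ^ 2 + a ^ 2 < ρ ^ 2 ↔
        Kerr.rPlus M' a' ^ 2 + a' ^ 2 < ρ ^ 2) := by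
      intro ρ
      have hρ := hext (ρ • E4.basisVector 1)
      rwa [mem_exterior_iff_of_pos hMa.pos, mem_exterior_iff_of_pos hMa'.pos,
        radius_equatorialRay, radius_equatorialRay, Real.lt_sqrt hpos.le, Real.lt_sqrt hpos'.le,
        lt_sub_iff_add_lt, lt_sub_iff_add_lt] at hρ
    have hsum : Kerr.rPlus M a ^ 2 + a ^ 2 = Kerr.rPlus M' a' ^ 2 + a' ^ 2 := by
      have h₁ := hequ (√(Kerr.rPlus M' a' ^ 2 + a' ^ 2))
      have h₂ := hequ (√(Kerr.rPlus M a ^ 2 + a ^ 2))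
      rw [Real.sq_sqrt (by positivity)] at h₁ h₂
      rcases lt_trichotomy (Kerr.rPlus M a ^ 2 + a ^ 2) (Kerr.rPlus M' a' ^ 2 + a' ^ 2) with
        hlt | heq | hgt
      · exact absurd (h₁.1 hlt) (lt_irrefl _)
      · exact heq
      · exact absurd (h₂.2 hgt) (lt_irrefl _)
    have ha : a ^ 2 = a' ^ 2 := by
      rw [hr] at hsum
      linarith
    have hM : M = M' := by
      have e₁ := rPlus_sq_add_sq_of_isSubextremal hMa
      have e₂ := rPlus_sq_add_sq_of_isSubextremal hMa'
      rw [hsum, hr] at e₁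
      have e := mul_right_cancel₀ hpos'.ne' (e₁.symm.trans e₂)
      linarith
    exact ⟨hM, (sq_eq_sq_iff_abs_eq_abs a a').1 ha⟩
  · rintro ⟨rfl, habs⟩
    have ha : a ^ 2 = a' ^ 2 := (sq_eq_sq_iff_abs_eq_abs a a').2 habs
    refine SetLike.ext fun x => ?_
    rw [mem_boostedKerrExterior, mem_boostedKerrExterior, exterior_eq_of_sq_eq M ha]

end Summit.FinalStateConjecture.FinalStateConjecture.Theorems.ClusterCompleteness

end
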